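import Literature.Analysis.FluidPDE.SwirlMaximumPrinciple
import HarnessLib

/-!
# The decaying barrier for the swirl equation
# (support item `SwirlSupStrictDecrease`, route `SwirlThreshold`, stmt-NavierStokesRegularity-2004)

Helper file for the proof of `SwirlSupStrictDecrease` (first half of the decay estimate
`abs_swirl_mul_le_of_classical` of the companion file `SwirlThresholdSwirlSupStrictDecreaseDecay`).
For a classical solution `(v, q)` of the unforced Navier–Stokes system (`ν > 0`) on
`[0, T] × ℝ³` with bounded (`|v| ≤ V`) axisymmetric velocity, the swirl `Γ = x₀v₁ − x₁v₀`
satisfies `∂ₜΓ + v·∇Γ = ν(ΔΓ − (2/r)∂ᵣΓ)` off the axis (`swirl_transport_holds`, KNSS 2009 (1.8)).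
This file proves that the decaying function
`h(t, y) = e^{βt} (M (1 + |y|²)⁻¹ + ε (1 + |y|²))`, `β = 6ν + V + 1`,
is a supersolution of that operator in the form consumed by the weak maximum principle
`Literature.Analysis.FluidPDE.weak_max_principle` (Lieberman 1996, Ch. II): at a point off the
axis where `∇(σΓ − h) = 0` and `Δ(σΓ − h) ≤ 0` one has `σΓₜ − ∂ₜh ≤ 0` (`barrier_subsolution`).
The computation: `∇h = 2G₁(|x|²)⟪x, ·⟫`, `Δh = 4G₂|x|² + 6G₁ ≤ e^{βt}(2M(1+|x|²)⁻¹ + 6ε(1+|x|²))`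
for the radial profile `G(σ) = e^{βt}(M(1 + σ)⁻¹ + ε(1 + σ))` (`laplacian_comp_norm_sq`), and
`σΓₜ = νσΔΓ − (2ν/r)∇h·e_r − ∇h·v ≤ (6ν + V) h` (`drift_terms_le`).
-/

noncomputable section

-- the summit and its single problem share the name (D-0017 nested layout)
set_option linter.dupNamespace false

open Set Function Filter Topology MeasureTheory InnerProductSpace Metric WithLp
open scoped RealInnerProductSpace Laplacian ContDiff NNReal

namespace Summit.NavierStokesRegularity.NavierStokesRegularity.Theorems.SwirlSupStrictDecrease

open Literature.Analysis.FluidPDE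

/-! ### The radial profile `G(σ) = B (M (1 + σ)⁻¹ + ε (1 + σ))` of the barrier -/

/-- First derivative of the profile `σ ↦ B (M (1 + σ)⁻¹ + ε (1 + σ))` at `σ > -1`. [folklore] -/
theorem hasDerivAt_profile (B M ε : ℝ) {σ : ℝ} (hσ : 0 < 1 + σ) :
    HasDerivAt (fun σ : ℝ => B * (M * (1 + σ)⁻¹ + ε * (1 + σ)))
      (B * (-(M * ((1 + σ) ^ 2)⁻¹) + ε)) σ := by
  have h2 : HasDerivAt (fun σ : ℝ => 1 + σ) 1 σ := by
    simpa using (hasDerivAt_id σ).const_add 1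
  have h1 : HasDerivAt (fun σ : ℝ => (1 + σ)⁻¹) (-((1 + σ) ^ 2)⁻¹ * 1) σ :=
    (hasDerivAt_inv hσ.ne').comp σ h2
  have h := ((h1.const_mul M).add (h2.const_mul ε)).const_mul B
  refine h.congr_deriv ?_
  ring

/-- Second derivative: the derivative of `σ ↦ B (−M (1 + σ)⁻² + ε)` at `σ > -1` is
`2 B M (1 + σ)⁻³`. [folklore] -/
theorem hasDerivAt_profile_deriv (B M ε : ℝ) {σ : ℝ} (hσ : 0 < 1 + σ) :
    HasDerivAt (fun σ : ℝ => B * (-(M * ((1 + σ) ^ 2)⁻¹) + ε))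
      (B * (2 * M * ((1 + σ) ^ 3)⁻¹)) σ := by
  have ha : HasDerivAt (fun σ : ℝ => 1 + σ) 1 σ := by
    simpa using (hasDerivAt_id σ).const_add 1
  have h2 : HasDerivAt (fun σ : ℝ => (1 + σ) ^ 2) (2 * (1 + σ)) σ := by
    refine ((ha.mul ha).congr_of_eventuallyEq (Eventually.of_forall fun y => ?_)).congr_deriv ?_
    · show (1 + y) ^ 2 = (1 + y) * (1 + y); ring
    · ring
  have hne : (1 + σ) ^ 2 ≠ 0 := pow_ne_zero 2 hσ.ne'
  have h1 : HasDerivAt (fun σ : ℝ => ((1 + σ) ^ 2)⁻¹) (-(((1 + σ) ^ 2) ^ 2)⁻¹ * (2 * (1 + σ))) σ :=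
    (hasDerivAt_inv hne).comp σ h2
  have h := (((h1.const_mul M).neg).add_const ε).const_mul B
  refine h.congr_deriv ?_
  set a : ℝ := (1 + σ)⁻¹ with hadef
  have hap : a * (1 + σ) = 1 := inv_mul_cancel₀ hσ.ne'
  have e4 : (((1 + σ) ^ 2) ^ 2)⁻¹ = a ^ 4 := by rw [← pow_mul, hadef, inv_pow]
  have e3 : ((1 + σ) ^ 3)⁻¹ = a ^ 3 := by rw [hadef, inv_pow]
  rw [e4, e3]
  linear_combination (2 * B * M * a ^ 3) * hap

/-- The elementary inequality behind the supersolution property of the barrier: with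
`p = 1 + s ≥ 1`, `a = p⁻¹`, the Laplacian `4 G₂ s + 6 G₁` of the profile is at most
`B (2 M a + 6 ε p)`. [folklore] -/
theorem laplacian_profile_le {B M ε s : ℝ} (hB : 0 ≤ B) (hM : 0 ≤ M) (hε : 0 ≤ ε) (hs : 0 ≤ s) :
    4 * (B * (2 * M * ((1 + s) ^ 3)⁻¹)) * s + 2 * 3 * (B * (-(M * ((1 + s) ^ 2)⁻¹) + ε)) ≤
      B * (2 * M * (1 + s)⁻¹ + 6 * ε * (1 + s)) := by
  set p : ℝ := 1 + s with hp
  have hp0 : 0 < p := by rw [hp]; linarith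
  set a : ℝ := p⁻¹ with ha
  have ha0 : 0 < a := inv_pos.2 hp0
  have hap : a * p = 1 := inv_mul_cancel₀ hp0.ne'
  have ha1 : a ≤ 1 := inv_le_one_of_one_le₀ (by rw [hp]; linarith)
  have h3 : (p ^ 3)⁻¹ = a ^ 3 := by rw [ha, inv_pow]
  have h2 : (p ^ 2)⁻¹ = a ^ 2 := by rw [ha, inv_pow]
  rw [h3, h2]
  have hs' : s = p - 1 := by rw [hp]; ring
  rw [hs']
  have e1 : a ^ 3 * p = a ^ 2 := by
    calc a ^ 3 * p = a ^ 2 * (a * p) := by ring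
      _ = a ^ 2 := by rw [hap, mul_one]
  have hMa : M * a ^ 2 ≤ M * a := by
    have : a ^ 2 ≤ a := by nlinarith
    exact mul_le_mul_of_nonneg_left this hM
  -- `LHS = B (8 M a² - 8 M a³ - 6 M a² + 6 ε) = B (2 M a² - 8 M a³ + 6 ε)`
  have eL : 4 * (B * (2 * M * a ^ 3)) * (p - 1) + 2 * 3 * (B * (-(M * a ^ 2) + ε)) =
      B * (2 * (M * a ^ 2) - 8 * (M * a ^ 3) + 6 * ε) := by
    linear_combination (8 * B * M) * e1
  rw [eL]
  refine mul_le_mul_of_nonneg_left ?_ hB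
  have h4 : 0 ≤ M * a ^ 3 := mul_nonneg hM (pow_nonneg ha0.le 3)
  have h5 : 6 * ε ≤ 6 * ε * p := by
    have : ε * 1 ≤ ε * p := mul_le_mul_of_nonneg_left (by rw [hp]; linarith) hε
    linarith
  linarith

/-- The drift terms at a critical point of `σΓ − h`: with `G₁ = B(−M(1 + n²)⁻² + ε)` the value of
the profile derivative at `s = n² = |x|²`, `−4νG₁ − 2G₁⟪x, v⟫ ≤ 4νBM(1+n²)⁻¹ + VB(M(1+n²)⁻¹ + ε(1+n²))`
whenever `|⟪x, v⟫| ≤ n V`. [folklore] -/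
theorem drift_terms_le {ν V B M ε n ip : ℝ} (hν : 0 < ν) (hV : 0 ≤ V) (hB : 0 < B) (hM : 0 ≤ M)
    (hε : 0 < ε) (hn : 0 ≤ n) (hip : |ip| ≤ n * V) :
    -(4 * ν * (B * (-(M * ((1 + n ^ 2) ^ 2)⁻¹) + ε))) -
        2 * (B * (-(M * ((1 + n ^ 2) ^ 2)⁻¹) + ε)) * ip ≤
      4 * ν * (B * (M * (1 + n ^ 2)⁻¹)) + V * (B * (M * (1 + n ^ 2)⁻¹ + ε * (1 + n ^ 2))) := by
  set p : ℝ := 1 + n ^ 2 with hp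
  have hp1 : 1 ≤ p := by rw [hp]; nlinarith
  have hp0 : 0 < p := by linarith
  set a : ℝ := p⁻¹ with ha
  have ha0 : 0 < a := inv_pos.2 hp0
  have hap : a * p = 1 := inv_mul_cancel₀ hp0.ne'
  have ha1 : a ≤ 1 := inv_le_one_of_one_le₀ hp1
  have h2 : (p ^ 2)⁻¹ = a ^ 2 := by rw [ha, inv_pow]
  rw [h2]
  set G₁ : ℝ := B * (-(M * a ^ 2) + ε) with hG₁
  -- first term
  have hT1 : -(4 * ν * G₁) ≤ 4 * ν * (B * (M * a)) := by
    have e : -(4 * ν * G₁) = 4 * ν * (B * (M * a ^ 2)) - 4 * ν * (B * ε) := by rw [hG₁]; ring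
    rw [e]
    have hMa : M * a ^ 2 ≤ M * a := by
      have : a ^ 2 ≤ a := by nlinarith
      exact mul_le_mul_of_nonneg_left this hM
    have h1 : 4 * ν * (B * (M * a ^ 2)) ≤ 4 * ν * (B * (M * a)) := by gcongr
    have h3 : 0 ≤ 4 * ν * (B * ε) := by positivity
    linarith
  -- second term
  have hT2 : -(2 * G₁ * ip) ≤ V * (B * (M * a + ε * p)) := by
    have hG₁abs : |G₁| ≤ B * (M * a ^ 2 + ε) := by
      rw [hG₁, abs_mul, abs_of_pos hB]
      refine mul_le_mul_of_nonneg_left ((abs_add_le _ _).trans ?_) hB.le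
      rw [abs_neg, abs_of_nonneg (by positivity), abs_of_pos hε]
    have h5 : -(2 * G₁ * ip) ≤ |2 * G₁ * ip| := neg_le_abs _
    have h6 : |2 * G₁ * ip| = 2 * |G₁| * |ip| := by rw [abs_mul, abs_mul, abs_two]
    have h7 : 2 * |G₁| * |ip| ≤ 2 * |G₁| * (n * V) := mul_le_mul_of_nonneg_left hip (by positivity)
    have hn2 : 2 * n ≤ p := by
      have h0 : 0 ≤ (n - 1) ^ 2 := sq_nonneg _
      have e0 : (n - 1) ^ 2 = p - 2 * n := by rw [hp]; ring
      linarith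
    have h8 : 2 * |G₁| * (n * V) ≤ (B * (M * a ^ 2 + ε)) * (p * V) := by
      have e : 2 * |G₁| * (n * V) = |G₁| * ((2 * n) * V) := by ring
      rw [e]
      exact mul_le_mul hG₁abs (mul_le_mul_of_nonneg_right hn2 hV) (by positivity) (by positivity)
    have e2 : (B * (M * a ^ 2 + ε)) * (p * V) = V * (B * (M * a + ε * p)) := by
      have e1 : a ^ 2 * p = a := by
        calc a ^ 2 * p = a * (a * p) := by ring
          _ = a := by rw [hap, mul_one]
      linear_combination (V * B * M) * e1
    linarith
  have e3 : -(4 * ν * G₁) - 2 * G₁ * ip = -(4 * ν * G₁) + -(2 * G₁ * ip) := by ring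
  rw [e3]
  exact add_le_add hT1 hT2

/-! ### The barrier `h(y) = B (M (1 + |y|²)⁻¹ + ε (1 + |y|²))` -/

/-- The barrier is smooth (`1 + |y|² > 0`). [folklore] -/
theorem barrier_contDiff (c M ε : ℝ) {n : WithTop ℕ∞} :
    ContDiff ℝ n (fun y : (EuclideanSpace ℝ (Fin 3)) => c * (M * (1 + ‖y‖ ^ 2)⁻¹ + ε * (1 + ‖y‖ ^ 2))) := by
  have hpos : ∀ y : (EuclideanSpace ℝ (Fin 3)), (1 : ℝ) + ‖y‖ ^ 2 ≠ 0 := fun y => by positivity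
  have h1 : ContDiff ℝ n (fun y : (EuclideanSpace ℝ (Fin 3)) => (1 : ℝ) + ‖y‖ ^ 2) :=
    contDiff_const.add (contDiff_norm_sq ℝ)
  have h2 : ContDiff ℝ n (fun y : (EuclideanSpace ℝ (Fin 3)) => ((1 : ℝ) + ‖y‖ ^ 2)⁻¹) := h1.inv hpos
  exact contDiff_const.mul ((contDiff_const.mul h2).add (contDiff_const.mul h1))

/-- Gradient of the barrier: `Dh(x) = 2 G₁(|x|²) ⟪x, ·⟫`, `G₁(σ) = B(−M(1 + σ)⁻² + ε)`. [folklore] -/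
theorem barrier_hasFDerivAt (B M ε : ℝ) (x : (EuclideanSpace ℝ (Fin 3))) :
    HasFDerivAt (fun y : (EuclideanSpace ℝ (Fin 3)) => B * (M * (1 + ‖y‖ ^ 2)⁻¹ + ε * (1 + ‖y‖ ^ 2)))
      ((2 * (B * (-(M * ((1 + ‖x‖ ^ 2) ^ 2)⁻¹) + ε))) • (innerSL ℝ x : (EuclideanSpace ℝ (Fin 3)) →L[ℝ] ℝ)) x := by
  have hs1 : (0 : ℝ) < 1 + ‖x‖ ^ 2 := by positivity
  exact hasFDerivAt_comp_norm_sq (g := fun σ : ℝ => B * (M * (1 + σ)⁻¹ + ε * (1 + σ)))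
    (hasDerivAt_profile B M ε hs1)

/-- Laplacian bound for the barrier: `Δh(x) ≤ B (2M(1 + |x|²)⁻¹ + 6ε(1 + |x|²))`
(`Δ(g(|·|²)) = 4g''|x|² + 6g'` on `ℝ³`, `laplacian_comp_norm_sq`, and `laplacian_profile_le`). [folklore] -/
theorem barrier_laplacian_le {B M ε : ℝ} (hB : 0 ≤ B) (hM : 0 ≤ M) (hε : 0 ≤ ε) (x : (EuclideanSpace ℝ (Fin 3))) :
    (Δ (fun y : (EuclideanSpace ℝ (Fin 3)) => (B * (M * (1 + ‖y‖ ^ 2)⁻¹ + ε * (1 + ‖y‖ ^ 2)) : ℝ))) x ≤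
      B * (2 * M * (1 + ‖x‖ ^ 2)⁻¹ + 6 * ε * (1 + ‖x‖ ^ 2)) := by
  have hs0 : (0 : ℝ) ≤ ‖x‖ ^ 2 := by positivity
  have hs1 : (0 : ℝ) < 1 + ‖x‖ ^ 2 := by positivity
  have hGd : ∀ σ ∈ Ioi (-1 : ℝ), HasDerivAt (fun σ : ℝ => B * (M * (1 + σ)⁻¹ + ε * (1 + σ)))
      (B * (-(M * ((1 + σ) ^ 2)⁻¹) + ε)) σ := fun σ hσ =>
    hasDerivAt_profile B M ε (by have h : (-1 : ℝ) < σ := hσ; linarith)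
  have hsU : ‖x‖ ^ 2 ∈ Ioi (-1 : ℝ) := by
    show (-1 : ℝ) < ‖x‖ ^ 2
    linarith
  have hG₁d := hasDerivAt_profile_deriv B M ε hs1
  have h := laplacian_comp_norm_sq (E := (EuclideanSpace ℝ (Fin 3))) (g := fun σ : ℝ => B * (M * (1 + σ)⁻¹ + ε * (1 + σ)))
    (g₁ := fun σ : ℝ => B * (-(M * ((1 + σ) ^ 2)⁻¹) + ε)) isOpen_Ioi hGd hsU hG₁d
  rw [finrank_euclideanSpace_fin] at h
  rw [h]
  push_cast
  have := laplacian_profile_le (B := B) (M := M) (ε := ε) hB hM hε hs0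
  linarith

/-! ### The sub-solution inequality at a critical point -/

/-- **The barrier is a supersolution.** Let `(v, q)` be a classical solution of the unforced
system (`ν > 0`) on `[0, T] × ℝ³` with axisymmetric velocity bounded by `V`, let `σ ∈ ℝ`,
`M ≥ 0`, `ε > 0`, `β = 6ν + V + 1`, and put `h(t, y) = e^{βt}(M(1 + |y|²)⁻¹ + ε(1 + |y|²))`.
At a point `(t, x)` off the axis where `∇(σΓ(t) − h(t)) = 0` and `Δ(σΓ(t) − h(t)) ≤ 0`, the
swirl equation (`swirl_transport_holds`) gives `σΓₜ ≤ νΔh − (2ν/r)∂ᵣh − v·∇h ≤ (6ν + V) h ≤ βh`,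
i.e. `σΓₜ − βh ≤ 0`. -/
theorem barrier_subsolution {T ν V M ε β σ : ℝ} {v : ℝ → (EuclideanSpace ℝ (Fin 3)) → (EuclideanSpace ℝ (Fin 3))} {q : ℝ → (EuclideanSpace ℝ (Fin 3)) → ℝ}
    (hν : 0 < ν) (hT : 0 < T) (hcl : IsClassicalNSSolutionOn (Icc 0 T) ν 0 v q)
    (haxi : ∀ t ∈ Icc 0 T, IsAxisymmetric (v t)) (hV : ∀ t ∈ Icc 0 T, ∀ x, ‖v t x‖ ≤ V)
    (hV0 : 0 ≤ V) (hM0 : 0 ≤ M) (hε : 0 < ε) (hβ : β = 6 * ν + V + 1)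
    {t : ℝ} (ht : t ∈ Ioc 0 T) {x : (EuclideanSpace ℝ (Fin 3))} (hr : cylRadius x ≠ 0)
    (hgrad : fderiv ℝ (fun y => σ * swirl (v t) y -
      Real.exp (β * t) * (M * (1 + ‖y‖ ^ 2)⁻¹ + ε * (1 + ‖y‖ ^ 2))) x = 0)
    (hlap : (Δ (fun y : (EuclideanSpace ℝ (Fin 3)) => (σ * swirl (v t) y -
      Real.exp (β * t) * (M * (1 + ‖y‖ ^ 2)⁻¹ + ε * (1 + ‖y‖ ^ 2)) : ℝ))) x ≤ 0) :
    σ * timeDerivWithin (Icc 0 T) (fun s => swirl (v s)) t x -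
      β * (Real.exp (β * t) * (M * (1 + ‖x‖ ^ 2)⁻¹ + ε * (1 + ‖x‖ ^ 2))) ≤ 0 := by
  have htI : t ∈ Icc 0 T := ⟨ht.1.le, ht.2⟩
  have hvC2 : ContDiff ℝ 2 (v t) := (hcl.contDiff_velocity htI).of_le (by norm_cast)
  have hvd : DifferentiableAt ℝ (v t) x := (hvC2.of_le one_le_two).differentiable one_ne_zero x
  set B : ℝ := Real.exp (β * t) with hBdef
  have hB0 : 0 < B := Real.exp_pos _
  set s : ℝ := ‖x‖ ^ 2 with hsdef
  have hs1 : 0 < 1 + s := by positivity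
  set G₁ : ℝ := B * (-(M * ((1 + s) ^ 2)⁻¹) + ε) with hG₁def
  -- the pressure is axisymmetric, so the swirl equation holds off the axis
  have hp : ∀ t ∈ Icc 0 T, IsAxisymmetricScalar (q t) := fun t ht =>
    hcl.isAxisymmetricScalar_pressure (uniqueDiffOn_Icc hT) haxi (fun _ _ => isAxisymmetric_zero) ht
  have hpde := swirl_transport_holds hcl haxi hp htI hr
  have hf0 : swirl ((0 : ℝ → (EuclideanSpace ℝ (Fin 3)) → (EuclideanSpace ℝ (Fin 3))) t) x = 0 := by simp [swirl]
  rw [hf0, add_zero, convect_apply, partialDeriv_apply] at hpde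
  -- the gradient condition: `σ ∇Γ = ∇h = 2 G₁ ⟪x, ·⟫`
  have hΓd : DifferentiableAt ℝ (swirl (v t)) x := differentiableAt_swirl hvd
  have hBar := barrier_hasFDerivAt B M ε x
  have hwderiv : HasFDerivAt (fun y => σ * swirl (v t) y -
      B * (M * (1 + ‖y‖ ^ 2)⁻¹ + ε * (1 + ‖y‖ ^ 2)))
      (σ • fderiv ℝ (swirl (v t)) x - (2 * G₁) • (innerSL ℝ x : (EuclideanSpace ℝ (Fin 3)) →L[ℝ] ℝ)) x :=
    (hΓd.hasFDerivAt.const_mul σ).sub hBar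
  have hDeq : σ • fderiv ℝ (swirl (v t)) x = (2 * G₁) • (innerSL ℝ x : (EuclideanSpace ℝ (Fin 3)) →L[ℝ] ℝ) := by
    have := hwderiv.fderiv
    rw [hgrad] at this
    exact (sub_eq_zero.1 this.symm)
  have hDapply : ∀ a : (EuclideanSpace ℝ (Fin 3)), σ * fderiv ℝ (swirl (v t)) x a = 2 * G₁ * ⟪x, a⟫ := fun a => by
    have := congrArg (fun L : (EuclideanSpace ℝ (Fin 3)) →L[ℝ] ℝ => L a) hDeq
    simpa [innerSL_apply_apply] using this
  -- the Laplacian condition: `σ ΔΓ ≤ Δh ≤ B (2M(1+s)⁻¹ + 6ε(1+s))`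
  have hΔ : σ * (Δ (swirl (v t))) x ≤ B * (2 * M * (1 + s)⁻¹ + 6 * ε * (1 + s)) := by
    have h1 : ContDiffAt ℝ 2 (fun y => σ * swirl (v t) y) x :=
      (contDiff_const.mul (contDiff_swirl hvC2)).contDiffAt
    have h2 : ContDiffAt ℝ 2 (fun y : (EuclideanSpace ℝ (Fin 3)) => B * (M * (1 + ‖y‖ ^ 2)⁻¹ + ε * (1 + ‖y‖ ^ 2))) x :=
      (barrier_contDiff B M ε).contDiffAt
    have h3 : (Δ (fun y : (EuclideanSpace ℝ (Fin 3)) => (σ * swirl (v t) y : ℝ))) x = σ * (Δ (swirl (v t))) x := by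
      have : (fun y : (EuclideanSpace ℝ (Fin 3)) => (σ * swirl (v t) y : ℝ)) = σ • swirl (v t) := by
        funext y; simp [smul_eq_mul]
      rw [this, laplacian_smul σ ((contDiff_swirl hvC2).contDiffAt), smul_eq_mul]
    have h4 := h1.laplacian_sub h2
    have hfun : (fun y => σ * swirl (v t) y - B * (M * (1 + ‖y‖ ^ 2)⁻¹ + ε * (1 + ‖y‖ ^ 2))) =
        (fun y => σ * swirl (v t) y) -
          fun y : (EuclideanSpace ℝ (Fin 3)) => B * (M * (1 + ‖y‖ ^ 2)⁻¹ + ε * (1 + ‖y‖ ^ 2)) := by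
      funext y; simp only [Pi.sub_apply]
    rw [hfun, h4, h3] at hlap
    have h5 := barrier_laplacian_le hB0.le hM0 hε.le x (B := B) (M := M) (ε := ε)
    linarith
  -- the drift terms
  have hrad : ν * (2 / cylRadius x) * (2 * G₁ * ⟪x, eR x⟫) = 4 * ν * G₁ := by
    rw [inner_self_eR_eq hr]
    have hrinv : (cylRadius x)⁻¹ * cylRadius x = 1 := inv_mul_cancel₀ hr
    have e : ν * (2 / cylRadius x) * (2 * G₁ * cylRadius x) =
        4 * ν * G₁ * ((cylRadius x)⁻¹ * cylRadius x) := by ring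
    rw [e, hrinv, mul_one]
  have hip : |⟪x, v t x⟫| ≤ ‖x‖ * V :=
    (abs_real_inner_le_norm _ _).trans (mul_le_mul_of_nonneg_left (hV t htI x) (norm_nonneg _))
  have hdrift := drift_terms_le (B := B) (M := M) (ε := ε) hν hV0 hB0 hM0 hε (norm_nonneg x) hip
  -- `σ Γₜ = ν σ ΔΓ - 4 ν G₁ - 2 G₁ ⟪x, v⟫ ≤ (6ν + V) h ≤ β h`
  have hΓeq : timeDerivWithin (Icc 0 T) (fun s => swirl (v s)) t x =
      ν * ((Δ (swirl (v t))) x - 2 / cylRadius x * fderiv ℝ (swirl (v t)) x (eR x)) -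
        fderiv ℝ (swirl (v t)) x (v t x) := eq_sub_of_add_eq hpde
  have e : σ * timeDerivWithin (Icc 0 T) (fun s => swirl (v s)) t x =
      ν * (σ * (Δ (swirl (v t))) x) -
        ν * (2 / cylRadius x) * (σ * fderiv ℝ (swirl (v t)) x (eR x)) -
        σ * fderiv ℝ (swirl (v t)) x (v t x) := by
    rw [hΓeq]; ring
  rw [e, hDapply (eR x), hDapply (v t x), hrad]
  have h1 : ν * (σ * (Δ (swirl (v t))) x) ≤ ν * (B * (2 * M * (1 + s)⁻¹ + 6 * ε * (1 + s))) :=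
    mul_le_mul_of_nonneg_left hΔ hν.le
  have hh0 : 0 ≤ B * (M * (1 + s)⁻¹ + ε * (1 + s)) := by positivity
  have e2 : ν * (B * (2 * M * (1 + s)⁻¹ + 6 * ε * (1 + s))) + (4 * ν * (B * (M * (1 + s)⁻¹)) +
      V * (B * (M * (1 + s)⁻¹ + ε * (1 + s)))) = (6 * ν + V) * (B * (M * (1 + s)⁻¹ + ε * (1 + s))) := by
    ring
  have e4 : β * (B * (M * (1 + s)⁻¹ + ε * (1 + s))) =
      (6 * ν + V) * (B * (M * (1 + s)⁻¹ + ε * (1 + s))) + B * (M * (1 + s)⁻¹ + ε * (1 + s)) := by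
    rw [hβ]; ring
  have hdrift' : -(4 * ν * G₁) - 2 * G₁ * ⟪x, v t x⟫ ≤
      4 * ν * (B * (M * (1 + s)⁻¹)) + V * (B * (M * (1 + s)⁻¹ + ε * (1 + s))) := by
    simpa only [hG₁def, hsdef] using hdrift
  linarith
where
  /-- `⟪x, e_r(x)⟫ = r(x)` off the axis. [folklore] -/
  inner_self_eR_eq {x : (EuclideanSpace ℝ (Fin 3))} (hx : cylRadius x ≠ 0) : ⟪x, eR x⟫ = cylRadius x := by
    rw [eR, real_inner_smul_right]
    have h : ⟪x, toLp 2 ![x 0, x 1, 0]⟫ = x 0 ^ 2 + x 1 ^ 2 := by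
      simp [PiLp.inner_apply, Fin.sum_univ_three]; ring
    rw [h, ← cylRadius_sq]
    field_simp

end Summit.NavierStokesRegularity.NavierStokesRegularity.Theorems.SwirlSupStrictDecrease

end
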